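import Mathlib
import Literature.MathematicalPhysics.QuantumLattice.FermiRG.Salmhofer1998Sec5
import HarnessLib

/-!
# Salmhofer, *Continuous renormalization for fermions and Fermi liquid theory* (CMP 194 (1998) 249):
# §5.1 the component RGE in momentum space (thermodynamic limit) and §6 "Regularity of the selfenergy" —
# the volume-improved bounds (Lemma 7), the ladder / skeleton split (Definitions 2–3), Theorems 3–7

Typer file F7e of the `gate-hubbard-kl` statements-first wave (D-0069 (2); DAG rows `Sal98.L6/L7/L8`,
`Sal98.T3`–`Sal98.T7`, HOME/DAG.tsv; licences F-090…F-097, wave-optional).  Source: M. Salmhofer, Commun.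
Math. Phys. **194** (1998) 249–295, arXiv:cond-mat/9706188 [Salmhofer1998]; locators `p.N Ln` = chunk
`pNNNN.txt` line `n` of the materialised arXiv TeX (`lit read arxiv:cond-mat/9706188`), NOT printed pages;
the stable locators are the paper's numbers (Lemma 6–8, Definition 2–3, Theorem 3–7; the displays of §6 are
quoted by content and by their TeX labels where the render lost the numbers — `\Ydef` (6.7), `\ieq1bou` (6.8),
`\ige3bou` (6.9), `\Kodef` (6.14), `\Xalli`/`\Xige3` (6.15)/(6.16), `\kKmrdef` (6.25), `\iha` (6.26),
`\ihb6`/`\ihb4`/`\ihb2` (6.27)–(6.29)).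

WHY (DECOMP.md K3 / risk-register item 3).  §6 is the printed `T > 0` statement that the skeleton
self-energy of the `d ≥ 2` many-fermion system is `C¹` UNIFORMLY in `β` and `C²` with second derivatives
`O((log β)²)` (`d = 2`), and that ONLY the ladder part of the four-point function is not bounded uniformly in
`β` (Theorems 3–5); Theorem 6 is the per-scale form — the bilinear term of the two-legged skeleton flow at
scale `ε_t = ε₀e^{-t}` obeys `|D^α Q^N_{2,r}(t)|_0 ≤ const · ε_t^{2-|α|} ((1+t)/2)^{δ_{d,2}}` with `β`-INDEPENDENT
constants given by the recursion (6.25).  This is the printed source of the per-scale factor "`|h| ≍ (1+t)`"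
at `|α| = 2`, `d = 2` that the cell's gen-4 typing question F1/Δ22 (HOME/STATUS 2026-08-26 20:48Z–21:37Z)
refers to; the statements below give it a Lean object to cite.  Nothing here asserts anything about the
Hubbard model.

## What is typed, and over what

* **§5.1/§5.3/§5.4 (p.17 L42 – p.18 L5, p.18 L114–131, p.19 L87–126): the component RGE in momentum space in
  the thermodynamic limit.**  Leg variables `K = (k, σ, j) ∈ Γ∞ = (𝕄(β) × 𝓑) × {-1,1} × {1,2}` are typed as
  `((k₀, 𝐤), σ, j) : (ℝ × Mom d) × Fin 2 × Fin 2` (`σ, j ↦ Fin 2`, `j`: `0 ↦ 1`, `1 ↦ 2` as in F7b's `DForm`),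
  `∼K = (-k, σ, 3-j)`; the `m`-point functions `I_{m,r}(t | K₁,…,K_m)` as a family `MomFamily`; the sup norm
  `|F|_0` (§5.3, p.18 L126–131) as an `ℝ≥0∞`-valued supremum (`supNorm`; `supNorm_le_ofReal_iff` unfolds it to the pointwise
  form used in the statements); loop integrals `∫ dK = Σ_{σ,j} ∫_{ℝ×𝓑} d^{d+1}k/(2π)^{d+1}` with the loop
  frequencies read through the step function `ω_β` of (5.13)–(5.14) (F7c `omegaStep`; "it is convenient to
  take `(p₀,𝐩) ∈ ℝ × 𝓑` and put all the `β`-dependence into the integrand", p.19 L90–92), the propagator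
  insertions `C̄_t(K) = (-1)^j Ĉ_t((-1)^j k)` (5.3) of an ABSTRACT scale family `C, Ċ : ℝ → (ℝ × Mom d) → ℂ`
  (first argument `t`; the frequency slot takes the Matsubara value directly), and the bilinear term
  `Q_{m,r}(t | P)` of (5.?) `\Qfour` (p.17 L139–152) with a TERM SELECTOR `sel` so that the full sum
  `∫dκ_{mr}`, the skeleton sum `∫dκ^S_{mr}` of Definition 2 (`m₁, m₂ ≥ 4`), the non-ladder truncation of
  Definition 3 (in addition the bubble term `(m; m₁, m₂, i) = (4; 4, 4, 2)` removed) and the ladder-only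
  system of Definition 3 are instances of ONE definition (`momQuadTerm`); the integral equation of Remark 5
  (`\equinteFou`, p.17 L156–163) as the predicate `IsMomRGESolution`.  The degree bound `m̄(r) = 2r + 2`
  (Lemma 3, p.18 L138–145) indexes F7b's `kappaSum`, which is REUSED (as are F7b's `antisym`, `Mom`, F7c's
  `omegaStep`, `bzBox`, `epsT`, `covC`, `covCDot`, `Display521`).  The many-fermion propagator (5.17) at a
  direct frequency argument is `modelProp M χ₁ t (x, 𝐤) = 𝒞_t(x, E(𝐤))` (so that `modelProp M χ₁ t (ω_β(p₀), 𝐩)`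
  is F7c's `cutoffCovInf M χ₁ β t p₀ 𝐩`, proved below `rfl`).
* **Derivatives.** `D^α` acts on the SPATIAL momenta `(𝐩₁,…,𝐩_m)` as iterated coordinate partial derivatives
  (`multiLegPartial α`, `α : Fin m → Fin d → ℕ`; one-leg version `multiMomPartial`).  §6.3 ¶1 (p.24 L84–93):
  derivatives in `p₀` "are understood as a difference operation … This changes at most constants, so I shall
  not write this out explicitly in the proofs" — the `p₀`-differences are therefore NOT typed with the
  constants of Theorems 6/7 (recorded here only).
* **§6.1 (p.22 L32 – p.23 L67).** `shellRegion` = `𝓡(ε)` (6.1); the overlapping-loop functional `Y_{α,i}(t)` of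
  (6.7) (`loopY`, with `n = i - 1` integrated lines); **Lemma 7** as the named fact `OverlappingLoopBound`
  (licence F-091) FOR THE MANY-FERMION PROPAGATOR (5.17): hypotheses = the §2.3 class of models (F7b
  `ModelData.Hyp`) with `d ≥ 2`, `k₀ > d` (§5.4 ¶1, p.19 L84–85), a cutoff `χ₁` (F7c `IsCutoff`), and constants
  `B_α`, `J₁` "of Lemma 4" characterised by the displays the printed proof invokes — (5.18) `\eist` and (5.21)
  `\drst` (F7c `Display521`) —; conclusions `Y = 0` for `t > log(βε₀/π)`, (6.8), and (6.9) with the constant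
  `K₀` EXISTENTIAL in `β`-independent position (print gives `K₀` by (6.14) from the chart Jacobian bounds
  `J₀, J₁`, `|E|₁`, `g₀` and the constant `Q_V` of Lemma 6; `J₀` and `Q_V` are not objects of this carrier —
  see "Faithfulness").
* **Lemma 6** (p.22 L46–67, the two-loop volume bound `𝓦(ε) ≤ Q_V ε (1 + |log ε|)` (`d = 2`), `Q_V ε`
  (`d ≥ 3`)) is, in the paper's words, "Theorem 1.2 of [FST2]" — this is the TREE's named fact
  `Literature.MathematicalPhysics.QuantumLattice.FermiRG.VolumeBound` with its object `volW`
  (`FST2Regularity.lean`, t4; [FST2]'s own numbering in the arXiv render is Theorem 1.1 `\bestvol`).  CITED,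
  not restated (licence F-090 is that decl).
* **Lemma 8** (p.23 L41–62, (6.15)/(6.16)) and the integrand family `𝓧_{α,i}` of (6.5) are NOT typed: they are
  the internal step "(6.6) = sup bound of (6.5)" × Lemma 7 of the proofs of Theorems 3, 6, 7, and the printed
  (6.5)/(6.6) suppress the chain rule through `k₁ = k₁(p)` (the `α₀/α₁/α₂` split differentiates the three
  FACTORS while (6.6) quotes the sup norms of the Green functions' OWN derivatives) — a literal transcription
  would not be a faithful closed `Prop`.  Recorded in this docstring (licence F-092 unused).
* **§6.2 (p.23 L69 – p.24 L80).** Definitions 2–3 as the selectors `selSkeleton` / `selNonLadder` / `selLadder`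
  and the ladder system `IsLadderSolution`; **Theorem 3** (`LadderFourPointBound`, F-093), **Theorem 4**
  (`SkeletonSelfEnergyRegularity`, F-094), **Theorem 5** (`SkeletonWithLadderBounds`, F-095).
* **§6.3 (p.24 L82 – p.25 L156).** The recursion (6.25) as the predicate `IsSkeletonK`; **Theorem 6**
  (`SkeletonRegularity`, F-096) and **Theorem 7** (`SkeletonLogBounds`, F-097).

## How the theorems are typed (the displays the proofs invoke as hypotheses; revision 2)

The objects of §5.1 (`momQuadTerm`, `IsMomRGESolution`, `loopY`, …) are defined for ANY scale family
`(C, Ċ)` on the leg space over `ℝ × [-π/ε, π/ε)^d` (inverse temperature `β` entering through `ω_β`).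
**Theorems 3–7** are typed, as print states them, FOR THE MANY-FERMION PROPAGATOR (5.17) of a model of the
§2.3 class (revisions 2 and 4).  **Theorem 3**'s printed proof ("by induction from (6.17) by use of (6.15)
with `i = 2` and `α = 0`", p.24 L8–10) takes no derivative and uses only `|∫F| ≤ ∫|F|`, `|𝔸₄F|_0 ≤ |F|_0` and
the `α = 0`, `i = 2` instance of (6.8), which is kept as its explicit hypothesis (a theorem for this propagator:
companion `Salmhofer1998OverlappingLoopInputs`, `ladderLoopHyp_modelProp`, with print's `B₀ = 4`); bounding
the spin sum of the bubble integrand term by term uses the measurability of the propagators (Mathlib's lower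
Lebesgue integral is an inner integral, subadditive only on measurable functions), which the model has and an
abstract family need not — hence Theorem 3 too is stated for the model (revision 4; revision 1–3 stated it for
an arbitrary family).  **Theorems 4–7** differentiate the right-hand side of the RGE in the external spatial momenta under
the loop integrals ((6.5)–(6.6)); their printed proofs use, besides the overlapping-loop bounds (6.8)/(6.9)
("Recall (6.15) and (6.16)", p.24 L161), the regularity of the propagators (5.17) established in Lemma 4
(`Ċ_t` is `C^{k₀}` in `𝐩` with the pointwise bounds (5.18); `Ĉ_t` is integrable, (5.21); both are step
functions of `p₀` through `ω_β` and smooth in `t`).  They are therefore typed FOR THE MANY-FERMION PROPAGATOR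
(5.17) of a model of the §2.3 class (`modelProp M χ₁`, `modelPropDot M χ₁` under `M.Hyp`, `d ≥ 2`, `k₀ > d`,
`IsCutoff χ₁`) — as print states them ("the skeleton selfenergy of the model", Definition 2, p.23 L76–77) —
with Lemma 7's conclusions (6.8)/(6.9) for that propagator kept as the explicit hypothesis `LoopBoundsHold …
(modelProp M χ₁) (modelPropDot M χ₁) B K₀ J₁` (Lemma 7 is the named fact `OverlappingLoopBound`; keeping its
conclusion as a hypothesis makes Theorems 4–7 independent of licence F-091 and of Lemma 6 = [FST2]).  Lemma 4's
vanishing beyond `log(βε₀/π)` is a THEOREM for this propagator (companion `Salmhofer1998SkeletonInputs`,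
`vanishesBeyond_modelProp`) and is not repeated as a hypothesis.  The initial data `I_{mr}(0)` of Theorems 4–7
are print's: `C²` in the spatial momenta with the bounds `K^{(0)}_{mr}` (p.24 L101–104) and — made explicit
here, print's Green functions living on the discrete set `Γ*^m` (p.17 L44–47, L110–111) — Borel measurable in
all leg variables (`InitialDataBounds`; see audit item 11).

Revision 2 (t7 g9, 2026-08-27; owner-lineage self-audit S-t7g9-1 of revision 1 = p478197): (i) clause (o) of
`OverlappingLoopBound` is stated on print's functional `loopYM` ((6.7) with `Q ∈ 𝕄(β) × ℝ^d`) instead of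
`loopY` (supremum over all real `Q`), for which it was false at `i = 1` (audit item 8); (ii) Theorems 4–7
re-typed for the many-fermion propagator as above — revision 1 stated them for an arbitrary scale family and
arbitrary initial data under hypotheses that do not force the regularity their derivative and `C²` clauses
need (audit item 11); (iii) `loopYM`, `loopYM_le_loopY` added; every other declaration, and every name, kept.
Revision 3 (t7 g9, referee ref-2 F1 + nits): the `m/2` clauses of Theorems 6–7 guarded by `2 ∣ m` (audit item
12); the unnumbered §5.3 displays of p.18 cited by locator only (F7c's (5.13)/(5.14) = `ω_β` scheme stands); the
proof display p.25 L56–60 no longer called "(6.33)" (that number is Theorem 7's first display).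
Revision 4 (t7 g9): Theorem 3 (`LadderFourPointBound`) typed for the many-fermion propagator like Theorems 4–7
(its proof's term-by-term bound of the spin sum needs measurable propagators); `VanishesBeyond` dropped there
(a theorem for this propagator); the `Y_{0,2}` hypothesis kept; conclusions unchanged.

## Faithfulness — a print audit of the constants (for the referee; every deviation is WEAKER than print)

The logical shape, the `ε_t`-powers, the `log(βε₀)`-powers, the `δ_{d,2}` case distinctions, the recursion
FORM (6.25) and the `β`-INDEPENDENCE of all constants ("Note that all bounds in this Theorem are independent
of `β`", p.24 L96–97) are typed verbatim.  The absolute numerical constants are typed existentially or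
enlarged, for the following reasons read on the page:
1. (6.28)/(6.29) print `((1+t)/2)²` resp. `(1+t)/2`; at `t = 0` this bounds `|D^α I(0)|` by `K_{mr}/4` resp.
   `K_{mr}/2`, which does not follow from the hypothesis `|D^α I_{mr}(0)| ≤ K^{(0)}_{mr} ≤ K_{mr}` — typed with
   `(1+t)²` resp. `(1+t)` (weaker).  Theorem 3 keeps the printed `((1+t)/2)^{r-1}` (its `L₂` is existential).
2. `M₀ = 240 B K₀` (p.24 L115) is typed as `∃ M₀` depending only on `(B, K₀)`: the printed (6.5)/(6.6) do not
   display the chain-rule constants through `k₁(p)` nor the `t`-integration constants, all absolute.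
3. (6.26) prints the constant `2K_{mr}` for every `m`; with the `1/m` of (6.25) this is consistent with the
   `s`-integration `∫_0^t e^{s(m/2-2+|α|)} ≤ e^{t(…)}/(m-4)` of (6.30) only for bounded `m` — typed `2K_{mr}` for
   `m ∈ {2, 4}` and `(m-4)K_{mr}` for `m ≥ 6` (`= 2K_{6r}`; weaker for `m ≥ 8`).  Same in (6.33).
4. (6.25) prints `∫dκ̃_{mr}`; (6.31) and the proof use the skeleton measure `∫dκ^S_{mr}` (`m₁, m₂ ≥ 4`, the
   four-legged `K_{4r_k}` NOT frozen — "For `m_k = 4`, [the inductive hypothesis] implies …", p.24 L154) — typed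
   `∫dκ^S`.  The display at p.25 L56–60 (proof of Theorem 6, case `m = 2`) prints `ε_t^{1-|α|}` where (6.26)
   (`m = 2`) has `ε_t^{2-|α|}`; (6.26) is typed.
5. (6.29) prints "`d = 3`"; Theorem 4 (6.20), which it implies, prints "`d ≥ 3`" — typed `d ≥ 3`.
6. (6.21) prints `log(βε₀)` (`|α| = 1`) and `βε₀` (`|α| = 2`) for the skeleton four-point function; integrating
   (6.26)/(6.28) gives `(1 + log(βε₀))²` and `βε₀ (1 + log(βε₀))` — typed in the latter, weaker form.
7. (6.9) prints `½(1+t)` for all `d ≥ 2`; for `d ≥ 3` Lemma 8 (6.16) and Theorem 6 use — and the printed proof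
   (6.12)–(6.14) via Lemma 6 without logarithm gives — the `t`-independent form: typed `((1+t)/2)^{δ_{d,2}}`,
   i.e. verbatim for `d = 2` and in (6.16)'s form for `d ≥ 3`.
8. Two readings of (6.7).  `loopY` takes the supremum over ALL `Q ∈ ℝ × ℝ^d`; `loopYM` is print's functional,
   `Q ∈ 𝕄(β) × 𝓑` (p.22 L108–110; over all of `ℝ^d` in the momentum, which is the same for periodic families and
   only stronger as a hypothesis otherwise); `loopYM ≤ loopY` (`loopYM_le_loopY`).  The BOUNDS (6.8)/(6.9) are
   typed on `loopY` — the printed proof is uniform in `Q₀`, which only enters an indicator `≤ 1`, and (5.18) is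
   assumed at every real frequency (the kernel bound of Lemma 4's proof) — and this wider form is what Theorems
   4–7 need at real external frequencies (p.24 L89–91).  The VANISHING (o) of Lemma 7 is typed on `loopYM`: at
   `i = 1` there is no integrated line and `loopY … α 0 t = sup_Q |D^α Ċ_t(Q)|` over all real `Q₀`, which does
   not vanish for any `t` (`Ċ_t(0, 𝐩) = -(2E(𝐩)/ε_t²) χ₁'(E(𝐩)²/ε_t²) ≠ 0` on `ε_t/2 < |E(𝐩)| < ε_t`), whereas at a
   Matsubara `Q₀` one has `|Q₀| ≥ π/β > ε_t` for `t > log(βε₀/π)` and `Ċ_t(Q₀, ·) ≡ 0` with all its spatial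
   derivatives — print's statement.  (Revision 1 typed (o) on `loopY`; false at `i = 1`, defect S-t7g9-1 D1.)
9. `k₁ = -(k₂+…+k_i) + p₁ + … + p_{m₁-i}`: the render prints the upper index `m₁-i+1` (p.17 L151–152, p.22 L96)
   where vertex 1 carries the `m₁ - i` external legs `P^{(1)} = (P₁,…,P_{m₁-i})` (p.17 L92) — typed
   structurally; signs of momentum routing are immaterial for every sup-norm statement here.  (6.17) prints a
   `½𝔸₄` inside `Q_{4,r,2}` and (6.19) applies `½𝔸₄` again; typed once, as in §5.1 (Theorem 3's `L₂` absorbs it).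
10. Exponents `r - 2` of `log(βε₀)` are natural-number subtractions (`= 0` at `r = 1`, where `Q_{m,1} = 0` and
   `K_{2,1} = 0` make every affected clause trivial).
11. Regularity behind the derivative clauses (revision 2, defect S-t7g9-1 D2).  `D^α` is typed through `fderiv`
   (`momPartial`, `legPartial`), which returns `0` where a function is not differentiable, and `loopInt` is a
   Bochner integral (`0` on non-integrable integrands).  For an ARBITRARY scale family `(C, Ċ)` and ARBITRARY
   initial data the hypotheses `LoopBoundsHold` + `InitialDataBounds` of revision 1 therefore did not force what
   the printed proofs of Theorems 4–7 use when they differentiate (6.5) under the loop integrals: that `Ċ_t` is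
   `C²` in `𝐩` with the pointwise bounds (5.18), that `Ĉ_t` is integrable, and that all integrands are measurable.
   Counter-family to revision 1's `SkeletonRegularity` clause (ii): `C ≡ 0`, `Ċ_s(x, 𝐤) = φ(s) w(k₁ - ½)` with
   `w` a tent and `φ` a bump on `[0, 0.6]`, `I_{4,1}(0) = v·ε(labels)`: all hypotheses hold (every `loopY` with an
   integrated line vanishes, the others are `sup |D^α Ċ_s|` with a junk second derivative `0`), yet the
   `(6; 4, 4, 1)` term makes `I_{6,2}(t | ·)` a sum of tents of `(𝐩_a + 𝐩_b + 𝐩_c)₁` — not `C¹`; and initial data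
   non-measurable in a loop frequency make `loopInt` jump between its value and `0` as an external momentum moves.
   Revision 2 states Theorems 4–7 for the propagator (5.17) of the §2.3 class (whose regularity is Lemma 4, in the
   tree) and adds Borel measurability of `I_{mr}(0)` in all leg variables to `InitialDataBounds` (automatic in
   print, whose Green functions live on the discrete set `Γ*^m`, p.17 L44–47 and L110–111; the `C²`-in-`𝐩`
   hypothesis of Theorem 6, p.24 L101, is kept as printed).  Theorem 3 and the `α = 0` clauses never
   differentiate; Theorem 3 is nevertheless typed for the model too (revision 4): its proof bounds the spin sum
   of the bubble integrand term by term, which in the kernel needs measurable propagators.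
12. `m` even (revision 3; referee ref-2 F1).  Print's exponent `2 - m/2 - |α|` in (6.26)/(6.27)/(6.33)/(6.34) has a
   real `m/2`; the typed exponent uses `(m / 2 : ℕ)`, which for ODD `m` floors and would claim a bound tighter than
   print by `ε_t^{-1/2}`.  In print `m` is always even ("all effective vertices occurring in our model have an even
   number of legs", p.23 L82–83; `∫dκ_{mr}` keeps `m₁, m₂` even, F7b `MIndex`, so `Q_{m,r} = 0` for odd `m`), so the
   four clauses are guarded by `2 ∣ m` — verbatim for even `m`, silent (as print is) for odd `m`.

No `instance`, no `notation`; nothing about the Hubbard model is asserted or denied; no sorry/axiom.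
Propositions 5–6 (p.21, the `d = 1` / `m > 2d+2` power counting remarks after Theorem 2) and Appendix A
(Theorems 8–9, Lemma 10: Wick ordering) are not typed here.
-/

noncomputable section

open MeasureTheory Filter
open scoped Topology ENNReal

namespace Literature.MathematicalPhysics.QuantumLattice.FermiRG

namespace Salmhofer1998

variable {d : ℕ}

/-! ### §5.1/§5.3 Legs, families, the sup norm `|·|_0`, spatial derivatives -/

/-- Frequency–momentum `k = (k₀, 𝐤) ∈ ℝ × 𝓑` (§5.4, p.19 L87–92: `p₀` real, the `β`-dependence through `ω_β`).
[cite: Salmhofer1998, §5.4 (p.19 L87–92)] -/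
abbrev FMom (d : ℕ) : Type := ℝ × Mom d

/-- A leg variable `K = (k, σ, j) ∈ Γ∞ = (𝕄(β) × 𝓑) × {-1,1} × {1,2}` (p.17 L46–47, p.18 L114–118); spin
`σ ↦ Fin 2`, Nambu index `j ∈ {1,2} ↦ Fin 2` (`0 ↦ 1 = ψ̄`, `1 ↦ 2 = ψ`, as in F7b's `DForm`).
[cite: Salmhofer1998, §5.1 (p.17 L46–47) and §5.3 (p.18 L114–118)] -/
abbrev Leg (d : ℕ) : Type := FMom d × Fin 2 × Fin 2

/-- `∼K = (-k, σ, 3-j)` (p.17 L58). [cite: Salmhofer1998, §5.1 (p.17 L58)] -/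
def legFlip (K : Leg d) : Leg d := (-K.1, K.2.1, K.2.2.rev)

/-- The momentum-space families `I_{m,r}(t | K₁,…,K_m)` (p.17 L102–116: the translation-reduced, totally
antisymmetric coefficient functions, extended off the momentum-conservation subspace by `I = Î ∘ Π_H`,
p.17 L118–130), indexed by legs `m`, order `r`, flow time `t`. [cite: Salmhofer1998, §5.1 (p.17 L102–130)] -/
abbrev MomFamily (d : ℕ) : Type := (m : ℕ) → ℕ → ℝ → (Fin m → Leg d) → ℂ

/-- **The sup norm `|F_m|_0 = sup_{P ∈ Γ∞^m} |F_m(P)|`** (§5.3, unnumbered display p.18 L126–131), `ℝ≥0∞`-valued (no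
junk value; `supNorm_le_ofReal_iff`). [cite: Salmhofer1998, §5.3 (p.18 L126–131)] -/
def supNorm {m : ℕ} (F : (Fin m → Leg d) → ℂ) : ℝ≥0∞ := ⨆ P : Fin m → Leg d, ‖F P‖ₑ

/-- The spatial momenta `(𝐩₁,…,𝐩_m)` of a leg configuration. [cite: Salmhofer1998, §6.3 (p.24 L84–93)] -/
def spatialOf {m : ℕ} (P : Fin m → Leg d) : Fin m → Mom d := fun μ => (P μ).1.2

/-- Replace the spatial momenta of a leg configuration (frequencies, spins, Nambu indices kept).
[cite: Salmhofer1998, §6.3 (p.24 L84–93)] -/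
def withSpatial {m : ℕ} (P : Fin m → Leg d) (q : Fin m → Mom d) : Fin m → Leg d :=
  fun μ => (((P μ).1.1, q μ), (P μ).2)

/-- `∂/∂(𝐩_μ)_ν F`, the coordinate partial derivative of an `m`-leg function in the `ν`-th component of the
`μ`-th spatial momentum (Fréchet derivative of the spatial section in a coordinate direction; junk `0` where not
differentiable). [cite: Salmhofer1998, Theorem 6 (p.24 L99–104)] -/
def legPartial {m : ℕ} (μ : Fin m) (ν : Fin d) (F : (Fin m → Leg d) → ℂ) : (Fin m → Leg d) → ℂ :=
  fun P => fderiv ℝ (fun q : Fin m → Mom d => F (withSpatial P q)) (spatialOf P)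
    (Pi.single μ (Pi.single ν 1))

/-- Iterated coordinate partials along a list of (leg, component) directions (outermost first).
[cite: Salmhofer1998, Theorem 6 (p.24 L99–104)] -/
def iterLegPartial {m : ℕ} (l : List (Fin m × Fin d)) (F : (Fin m → Leg d) → ℂ) : (Fin m → Leg d) → ℂ :=
  l.foldr (fun μν G => legPartial μν.1 μν.2 G) F

/-- `|α| = Σ_{μ,ν} α_{μν}` for a spatial multi-index over `m` legs. [cite: Salmhofer1998, Theorem 6 (p.24 L99–100)] -/
def lmiDeg {m : ℕ} (α : Fin m → Fin d → ℕ) : ℕ := ∑ μ, ∑ ν, α μ ν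

/-- `D^α F` for a spatial multi-index `α` over the `m` legs (coordinate order; immaterial on `C^{|α|}`
functions).  The `p₀`-components of print's multi-indices (finite differences, §6.3 ¶1) are not included —
see the module docstring. [cite: Salmhofer1998, Theorem 6 (p.24 L99–104) and §6.3 (p.24 L84–93)] -/
def multiLegPartial {m : ℕ} (α : Fin m → Fin d → ℕ) (F : (Fin m → Leg d) → ℂ) : (Fin m → Leg d) → ℂ :=
  iterLegPartial ((List.finRange m).flatMap fun μ => (List.finRange d).flatMap fun ν =>
    List.replicate (α μ ν) (μ, ν)) F

/-- `∂/∂𝐩_ν f` for a one-leg (propagator-type) function of `k = (k₀, 𝐤)` at fixed frequency.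
[cite: Salmhofer1998, Lemma 4 (5.18) (p.19 L136–145)] -/
def momPartial (ν : Fin d) (f : FMom d → ℂ) : FMom d → ℂ :=
  fun k => fderiv ℝ (fun q : Mom d => f (k.1, q)) k.2 (Pi.single ν 1)

/-- Iterated one-leg partials. [cite: Salmhofer1998, Lemma 4 (5.18) (p.19 L136–145)] -/
def iterMomPartial (l : List (Fin d)) (f : FMom d → ℂ) : FMom d → ℂ :=
  l.foldr (fun ν g => momPartial ν g) f

/-- `|α|` for `α ∈ ℕ₀^d`. [cite: Salmhofer1998, Lemma 4 (p.19 L136)] -/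
def miDeg (α : Fin d → ℕ) : ℕ := ∑ ν, α ν

/-- `D^α f` for `α ∈ ℕ₀^d` acting on the spatial momentum of a one-leg function.
[cite: Salmhofer1998, Lemma 4 (5.18) (p.19 L136–145)] -/
def multiMomPartial (α : Fin d → ℕ) (f : FMom d → ℂ) : FMom d → ℂ :=
  iterMomPartial ((List.finRange d).flatMap fun ν => List.replicate (α ν) ν) f

/-! ### §5.1/§5.4 Loop integration, propagator insertions, the bilinear term `Q_{m,r}` in momentum space -/

/-- The loop variables made Matsubara, `(k₀, 𝐤) ↦ (ω_β(k₀), 𝐤)` ((5.13)–(5.14): `∫_ℝ dp₀/(2π) f(ω_β(p₀)) =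
β⁻¹ Σ_{ω ∈ 𝕄(β)} f(ω)`). [cite: Salmhofer1998, §5.4 (5.13)–(5.14) (p.19 L93–105)] -/
def toMats (β : ℝ) (k : FMom d) : FMom d := (omegaStep β k.1, k.2)

/-- The integration region `(ℝ × [-π/ε, π/ε)^d)^n` of `n` loop lines (`𝓑` realised by F7c's `bzBox`).
[cite: Salmhofer1998, §5.3 (p.18 L114–125)] -/
def loopSet (d : ℕ) (latt : ℝ) (n : ℕ) : Set (Fin n → FMom d) :=
  Set.pi Set.univ fun _ => (Set.univ : Set ℝ) ×ˢ bzBox d latt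

/-- The measure normalisation `((2π)^{-(d+1)})^n` of `∏_s d^{d+1}k_s/(2π)^{d+1}` ((5.20)–(5.21), (5.14)).
[cite: Salmhofer1998, Lemma 4 (5.20)–(5.21) (p.19 L154–164)] -/
def loopWeight (d n : ℕ) : ℝ := (((2 * Real.pi) ^ (d + 1))⁻¹) ^ n

/-- `∫ dK₁ ⋯ dK_n F(K) = Σ_{σ,j} ∫ ∏_s d^{d+1}k_s/(2π)^{d+1} F(((ω_β(k_{s,0}), 𝐤_s), σ_s, j_s)_s)` over `n` loop legs
(p.17 L141: `∫ dK₂ … dK_i`, with `∫_{Γ∞} dK = Σ_{σ,j} β⁻¹ Σ_ω ∫_𝓑 d^d𝐤/(2π)^d` written through `ω_β`).  Bochner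
integral (value `0` on non-integrable integrands; in the intended use all integrands are bounded and compactly
supported in the frequencies). [cite: Salmhofer1998, §5.1 (p.17 L139–152) and §5.4 (5.14) (p.19 L100–105)] -/
def loopInt (latt β : ℝ) (n : ℕ) (F : (Fin n → Leg d) → ℂ) : ℂ :=
  ∑ sj : Fin n → Fin 2 × Fin 2,
    ∫ k in loopSet d latt n, (loopWeight d n : ℂ) * F (fun s => (toMats β (k s), sj s))

/-- **(5.3)** the propagator insertion `C̄_t(K) = (-1)^j Ĉ_t((-1)^j k)` for `K = (k, σ, j)` (p.17 L70–76; the sign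
combination makes the position-space covariance antisymmetric), for a scale family `C : ℝ → (ℝ × Mom d) → ℂ`,
`(t, k) ↦ Ĉ_t(k)`. [cite: Salmhofer1998, §5.1 (5.3) (p.17 L61–76)] -/
def legProp (C : ℝ → FMom d → ℂ) (t : ℝ) (K : Leg d) : ℂ :=
  if K.2.2 = 0 then -C t (-K.1) else C t K.1

/-- The degree bound `m̄(r) = 2r + 2` of the order-`r` functions of the (quartic) many-fermion model (Lemma 3,
p.18 L138–145: `I_{mr}(t) = 0` if `m > 2r+2`), indexing F7b's `kappaSum`. [cite: Salmhofer1998, Lemma 3 (p.18 L138–145)] -/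
def mfDeg (r : ℕ) : ℕ := 2 * r + 2

/-- Term selector: the full sum `∫dκ_{mr}` of §5.1. [cite: Salmhofer1998, §5.1 (p.17 L139–141)] -/
def selAll : ℕ → ℕ → ℕ → ℕ → Bool := fun _ _ _ _ => true

/-- **Definition 2 (p.23 L71–77)**: the skeleton sum `∫dκ^S_{mr}` — "the sums over `m₁` and `m₂` start at four
instead of two" (no two-legged insertions). [cite: Salmhofer1998, Definition 2 (p.23 L71–77)] -/
def selSkeleton : ℕ → ℕ → ℕ → ℕ → Bool := fun _ m₁ m₂ _ => decide (4 ≤ m₁) && decide (4 ≤ m₂)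

/-- **Definition 3 (p.23 L142–160)**, the skeleton (non-ladder) truncation generating `I^N_{m,r}`: the skeleton
sum with, in the four-point equation, the bubble term `m₁ = m₂ = 4` (`i = 2`, Figure 3, `Q_{4,r,2}` of (6.17))
left out ("`∂B_r/∂t = 0, B_r(0) = 0`"). [cite: Salmhofer1998, Definition 3 (p.23 L142–160)] -/
def selNonLadder : ℕ → ℕ → ℕ → ℕ → Bool := fun m m₁ m₂ i =>
  selSkeleton m m₁ m₂ i && !(decide (m = 4) && decide (m₁ = 4) && decide (m₂ = 4))

/-- **Definition 3 (p.23 L142–150)**, the ladder truncation generating `B^L_r`: only the bubble term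
`(m; m₁, m₂) = (4; 4, 4)` of the four-point equation ("`∂U_r/∂t = 0, U_r(0) = 0`"; (6.17)–(6.19)).
[cite: Salmhofer1998, Definition 3 (p.23 L142–150) and (6.17)–(6.19) (p.23 L101–140)] -/
def selLadder : ℕ → ℕ → ℕ → ℕ → Bool := fun m m₁ m₂ _ =>
  decide (m = 4) && decide (m₁ = 4) && decide (m₂ = 4)

/-- **The bilinear term of the momentum-space RGE** ((5.?) `\Qfour`, p.17 L135–152), in the thermodynamic limit:
`Q_{m,r}(t | P) = ∫dκ_{mr} i!·i ∫ dK₂…dK_i Σ_{σ₁,j₁} (-Ċ̄_t(K₁)) ∏_{s=2}^i C̄_t(K_s) I_{m₁r₁}(t | P^{(1)}, K) I_{m₂r₂}(t | ∼K, P^{(2)})`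
with `P^{(1)} = (P₁,…,P_{m₁-i})`, `P^{(2)} = (P_{m₁-i+1},…,P_m)`, `K = (K₁,…,K_i)`, `∼K = (∼K_i,…,∼K₁)` and
`k₁ = -(k₂+…+k_i) + p₁+…+p_{m₁-i}` fixed by momentum conservation (the render prints the upper index `m₁-i+1`;
structurally vertex 1 carries `m₁-i` external legs — module docstring, audit item 9).  The selector `sel m m₁ m₂ i`
picks the terms kept (`selAll` / `selSkeleton` / `selNonLadder` / `selLadder`); `∫dκ_{mr}` with the degree bound
`m̄(r) = 2r+2` is F7b's `kappaSum`.  The two vertex families are supplied separately (`I₁`, `I₂`).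
[cite: Salmhofer1998, §5.1 (p.17 L135–152)] -/
def momQuadTerm (latt β : ℝ) (sel : ℕ → ℕ → ℕ → ℕ → Bool) (C Cdot : ℝ → FMom d → ℂ)
    (I₁ I₂ : MomFamily d) (m r : ℕ) (t : ℝ) (P : Fin m → Leg d) : ℂ :=
  kappaSum mfDeg m r fun r₁ m₁ r₂ m₂ i =>
    if h : i ≤ m₁ ∧ i ≤ m₂ ∧ m₁ + m₂ = m + 2 * i then
      if sel m m₁ m₂ i then
        (((i.factorial * i : ℕ) : ℝ) : ℂ) *
          loopInt latt β (i - 1) fun K : Fin (i - 1) → Leg d =>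
            ∑ sj₁ : Fin 2 × Fin 2,
              (-(legProp Cdot t
                  ((-(∑ s, (K s).1) + ∑ μ : Fin (m₁ - i), (P ⟨μ.val, by omega⟩).1), sj₁))) *
                (∏ s, legProp C t (K s)) *
                I₁ m₁ r₁ t (fun j : Fin m₁ =>
                  if hj : j.val < m₁ - i then P ⟨j.val, by omega⟩
                  else if hj' : j.val = m₁ - i then
                    ((-(∑ s, (K s).1) + ∑ μ : Fin (m₁ - i), (P ⟨μ.val, by omega⟩).1), sj₁)
                  else K ⟨j.val - (m₁ - i) - 1, by omega⟩) *
                I₂ m₂ r₂ t (fun j : Fin m₂ =>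
                  if hj : j.val < i - 1 then legFlip (K ⟨(i - 2) - j.val, by omega⟩)
                  else if hj' : j.val = i - 1 then
                    legFlip ((-(∑ s, (K s).1) + ∑ μ : Fin (m₁ - i), (P ⟨μ.val, by omega⟩).1), sj₁)
                  else P ⟨(m₁ - i) + (j.val - i), by omega⟩)
      else 0
    else 0

/-- **The momentum-space RGE as an integral equation** (Remark 5 (5.?) `\equinteFou`, p.17 L156–163, with
p.18 L1–6: the right side involves only orders `r₁, r₂ < r`, so the equation and the initial condition
determine the family uniquely): `I_{m,r}(t | P) = I_{m,r}(0 | P) + ½ 𝔸_m ∫_0^t ds Q_{m,r}(s | P)` for `t ≥ 0`,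
the bilinear term built from the family itself with the terms selected by `sel` (`𝔸_m` = F7b's `antisym`).
[cite: Salmhofer1998, Remark 5 (p.17 L156–163) and Definitions 2–3 (p.23 L71–160)] -/
def IsMomRGESolution (latt β : ℝ) (sel : ℕ → ℕ → ℕ → ℕ → Bool) (C Cdot : ℝ → FMom d → ℂ)
    (I : MomFamily d) : Prop :=
  ∀ (m r : ℕ) (t : ℝ), 0 ≤ t → ∀ P : Fin m → Leg d,
    I m r t P = I m r 0 P +
      (2 : ℂ)⁻¹ * antisym (fun P' => ∫ s in (0 : ℝ)..t, momQuadTerm latt β sel C Cdot I I m r s P') P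

/-- A family of four-point functions `(B_r)_r` viewed as a `MomFamily` vanishing off `m = 4`.
[cite: Salmhofer1998, Definition 3 (p.23 L142–150)] -/
def fourPointFamily (BL : ℕ → ℝ → (Fin 4 → Leg d) → ℂ) : MomFamily d := fun m r t P =>
  if h : m = 4 then BL r t (fun j => P (Fin.cast h.symm j)) else 0

/-- **Definition 3 (p.23 L142–150): the ladder skeleton four-point function `B^L_r`** — the solution of the
four-point equation with only the bubble term kept, `∂B_r/∂t = ½𝔸₄ Q_{4,r,2}` ((6.17)–(6.19)), `U_r ≡ 0`, initial
condition `B_r(0) = I^S_{4,r}(0)` (p.23 L135). [cite: Salmhofer1998, Definition 3 (p.23 L142–150)] -/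
def IsLadderSolution (latt β : ℝ) (C Cdot : ℝ → FMom d → ℂ) (BL : ℕ → ℝ → (Fin 4 → Leg d) → ℂ) : Prop :=
  IsMomRGESolution latt β selLadder C Cdot (fourPointFamily BL)

/-- The many-fermion propagator (5.17) at a direct frequency argument, `(t, (x, 𝐤)) ↦ 𝒞_t(x, E(𝐤))` (F7c `covC`);
at `x = ω_β(p₀)` this is the thermodynamic-limit propagator `D̂_t(p)` (F7c `cutoffCovInf`, see
`modelProp_toMats`). [cite: Salmhofer1998, §5.4 (5.17) (p.19 L118–126)] -/
def modelProp (M : ModelData d) (χ₁ : ℝ → ℝ) : ℝ → FMom d → ℂ :=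
  fun t k => covC χ₁ M.eps0 t k.1 (M.E k.2)

/-- Its `t`-derivative `Ċ_t` (F7c `covCDot`). [cite: Salmhofer1998, §5.4–5.5 (p.20 L5–6, L80–82)] -/
def modelPropDot (M : ModelData d) (χ₁ : ℝ → ℝ) : ℝ → FMom d → ℂ :=
  fun t k => covCDot χ₁ M.eps0 t k.1 (M.E k.2)

/-! ### §6.1 Volume-improved bounds: `𝓡(ε)`, the functional `Y_{α,i}`, Lemma 7 -/

/-- **(6.1)** `𝓡(ε) = {𝐩 ∈ 𝓑 : |E(𝐩)| ≤ ε}` (p.22 L34–39), as a subset of momentum space (intersect with a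
fundamental domain of `𝓑` where a volume is meant). [cite: Salmhofer1998, §6.1 (6.1) (p.22 L34–39)] -/
def shellRegion (E : Mom d → ℝ) (ε : ℝ) : Set (Mom d) := {p | |E p| ≤ ε}

/-- The left side of (5.21) for a scale family: `∫_{ℝ×𝓑} d^{d+1}k/(2π)^{d+1} |Ĉ_t(ω_β(k₀), 𝐤)|` (`ℝ≥0∞`-valued).
For `modelProp` this is F7c's `covL1Momentum` (`propL1_modelProp`). [cite: Salmhofer1998, Lemma 4 (5.21) (p.19 L160–164)] -/
def propL1 (latt β : ℝ) (C : ℝ → FMom d → ℂ) (t : ℝ) : ℝ≥0∞ :=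
  ENNReal.ofReal (loopWeight d 1) * ∫⁻ k in (Set.univ : Set ℝ) ×ˢ bzBox d latt, ‖C t (toMats β k)‖ₑ

/-- **(6.7)** the overlapping-loop functional
`Y_{α,i}(t) = sup_Q max_{v_j = ±1} ∫ ∏_{j=2}^i |Ĉ_t(k_j)| dk_j |D^α Ċ_t(Σ_{j=2}^i v_j k_j + Q)|` (p.22 L108–115), with
`n = i - 1` integrated lines, `dk_j = d^{d+1}k_j/(2π)^{d+1}` over `ℝ × 𝓑` read through `ω_β`; the supremum is taken
over all `Q ∈ ℝ × ℝ^d` (audit item 8). `ℝ≥0∞`-valued. [cite: Salmhofer1998, §6.1 (6.7) (p.22 L108–115)] -/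
def loopY (latt β : ℝ) (C Cdot : ℝ → FMom d → ℂ) (α : Fin d → ℕ) (n : ℕ) (t : ℝ) : ℝ≥0∞ :=
  ⨆ Q : FMom d, ⨆ v : Fin n → Bool,
    ∫⁻ k in loopSet d latt n,
      ENNReal.ofReal (loopWeight d n) * (∏ j, ‖C t (toMats β (k j))‖ₑ) *
        ‖multiMomPartial α (Cdot t) ((∑ j, (if v j then (1 : ℝ) else -1) • toMats β (k j)) + Q)‖ₑ

/-- **(6.7) as printed**: the same functional with the supremum over `Q = (Q₀, 𝐪) ∈ 𝕄(β) × ℝ^d`, `Q₀` a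
Matsubara frequency `(π/β)(2n'+1)` (p.22 L108–110: `sup_{Q ∈ 𝕄(β) × 𝓑}`; the momentum over all of `ℝ^d`,
audit item 8).  `loopYM ≤ loopY` (`loopYM_le_loopY`).  Lemma 7's vanishing statement (o) is typed on this
functional. `ℝ≥0∞`-valued. [cite: Salmhofer1998, §6.1 (6.7) (p.22 L108–115)] -/
def loopYM (latt β : ℝ) (C Cdot : ℝ → FMom d → ℂ) (α : Fin d → ℕ) (n : ℕ) (t : ℝ) : ℝ≥0∞ :=
  ⨆ n' : ℤ, ⨆ q : Mom d, ⨆ v : Fin n → Bool,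
    ∫⁻ k in loopSet d latt n,
      ENNReal.ofReal (loopWeight d n) * (∏ j, ‖C t (toMats β (k j))‖ₑ) *
        ‖multiMomPartial α (Cdot t)
          ((∑ j, (if v j then (1 : ℝ) else -1) • toMats β (k j)) + (matsFreq β n', q))‖ₑ

/-- The dimension factor `((1+t)/2)^{δ_{d,2}}` of (6.16)/(6.26) (`½(1+t)` if `d = 2`, `1` if `d ≥ 3`).
[cite: Salmhofer1998, Lemma 8 (6.16) (p.23 L55–62)] -/
def twoLoopFactor (d : ℕ) (t : ℝ) : ℝ := if d = 2 then (1 + t) / 2 else 1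

/-- **Lemma 7 (p.22 L117 – p.23 L37; TeX `\Ylemma`)**, for the many-fermion propagator (5.17) of the §2.3 class
of models in `d ≥ 2` with `k₀ > d` (standing assumption of §5.4, p.19 L84–85) and a cutoff `χ₁`, with `B_α`,
`J₁` the constants of Lemma 4 — typed as ANY constants for which (5.18) (`|D^α Ċ_t(p)| ≤ B_α ε_t^{-1-|α|}
𝟙(|p₀| ≤ ε_t) 𝟙(|E(𝐩)| ≤ ε_t)`, at every real frequency) and (5.21) (`∫|Ĉ_t| ≤ 8J₁ε_t`, F7c `Display521`) hold
for all `β` in the window `βε₀ ≥ 6` and all `t ≥ 0`: (o) `Y_{α,i}(t) = 0` for `t > log(βε₀/π)` — on print's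
functional `loopYM` (`Q ∈ 𝕄(β) × ℝ^d`; for every multi-index and every `i ≥ 1`; audit item 8: revision 1 typed
it on `loopY`, where it fails at `i = 1`); **(6.8)** `Y_{α,i}(t) ≤ (8J₁)^{i-1} B_α ε_t^{i-2-|α|}`; and **(6.9)**,
for `i ≥ 3`, `Y_{α,i}(t) ≤ (8J₁)^{i-1} B_α K₀ ((1+t)/2)^{δ_{d,2}} ε_t^{i-1-|α|}` with a constant `K₀ > 0`
INDEPENDENT of `β` — both on the wider functional `loopY` (all real `Q`; they imply the printed ones by
`loopYM_le_loopY`) (print: `K₀` given by (6.14), `K₀ = 2 (J₀/J₁)² Q_V (1 + 4|E|₁/g₀)(1 + log(1 + 4|E|₁/g₀) +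
|log ε₀|)`, from the chart Jacobian bound `J ≤ J₀`, `|E|₁ = |∇E|₀`, `g₀` of §2.3 and `Q_V` of Lemma 6 = [FST2]'s
two-loop volume theorem = the tree's `FermiRG.VolumeBound`; typed existentially — module docstring, and audit
item 7 for the `d ≥ 3` form).  Multi-indices `|α| ≤ k₀` as in Lemma 4 for the bounds.  (o) and (6.8) are
elementary from (5.18)/(5.21) (print: "By (5.18) … so", p.23 L1–6); (6.9) is the overlapping-loop volume
argument (6.10)–(6.14) resting on Lemma 6.  Named fact (licence F-091). `Sal98.L7` · Salmhofer 1998 Lemma 7 ·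
p.22 L117–131. [cite: Salmhofer1998, Lemma 7 (p.22 L117 – p.23 L37)] -/
def OverlappingLoopBound : Prop :=
  ∀ (d : ℕ) (M : ModelData d), 2 ≤ d → M.Hyp → d < M.k0 →
  ∀ (χ₁ : ℝ → ℝ), IsCutoff χ₁ →
  ∀ (B : (Fin d → ℕ) → ℝ) (J₁ : ℝ), (∀ α, 0 ≤ B α) → 0 < J₁ →
    (∀ β : ℝ, 0 < β → 6 ≤ β * M.eps0 → ∀ t : ℝ, 0 ≤ t → ∀ α : Fin d → ℕ, miDeg α ≤ M.k0 →
      ∀ (x : ℝ) (p : Mom d),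
        ‖multiMomPartial α (modelPropDot M χ₁ t) (x, p)‖ ≤
          B α * (epsT M.eps0 t)⁻¹ ^ (1 + miDeg α) *
            (if |x| ≤ epsT M.eps0 t then 1 else 0) * (if |M.E p| ≤ epsT M.eps0 t then 1 else 0)) →
    (∀ β : ℝ, 0 < β → 6 ≤ β * M.eps0 → ∀ t : ℝ, 0 ≤ t → Display521 M χ₁ β J₁ t) →
    -- (o) vanishing beyond `log(βε₀/π)`, on print's functional (6.7) (`Q ∈ 𝕄(β) × ℝ^d`)
    (∀ β : ℝ, 0 < β → 6 ≤ β * M.eps0 → ∀ t : ℝ, Real.log (β * M.eps0 / Real.pi) < t →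
      ∀ (α : Fin d → ℕ) (n : ℕ), loopYM M.latt β (modelProp M χ₁) (modelPropDot M χ₁) α n t = 0) ∧
    -- (6.8)
    (∀ β : ℝ, 0 < β → 6 ≤ β * M.eps0 → ∀ t : ℝ, 0 ≤ t → ∀ α : Fin d → ℕ, miDeg α ≤ M.k0 →
      ∀ i : ℕ, 1 ≤ i →
        loopY M.latt β (modelProp M χ₁) (modelPropDot M χ₁) α (i - 1) t ≤
          ENNReal.ofReal ((8 * J₁) ^ (i - 1) * B α * epsT M.eps0 t ^ ((i : ℤ) - 2 - (miDeg α : ℤ)))) ∧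
    -- (6.9), `K₀` independent of `β`
    ∃ K₀ : ℝ, 0 < K₀ ∧
      ∀ β : ℝ, 0 < β → 6 ≤ β * M.eps0 → ∀ t : ℝ, 0 ≤ t → ∀ α : Fin d → ℕ, miDeg α ≤ M.k0 →
        ∀ i : ℕ, 3 ≤ i →
          loopY M.latt β (modelProp M χ₁) (modelPropDot M χ₁) α (i - 1) t ≤
            ENNReal.ofReal ((8 * J₁) ^ (i - 1) * B α * K₀ * twoLoopFactor d t *
              epsT M.eps0 t ^ ((i : ℤ) - 1 - (miDeg α : ℤ)))

/-! ### §6.2–6.3 The hypotheses shared by Theorems 3–7 (the displays their proofs invoke) -/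

/-- The overlapping-loop input of Theorems 4–7 for a scale family `(C, Ċ)`: (6.8) for `1 ≤ i`, `|α| ≤ 2` with
`B_α ≤ B`, and (6.9) (in the `((1+t)/2)^{δ_{d,2}}` form of (6.16)) for `i ≥ 3`, for all `t ≥ 0` — i.e. the
conclusions of Lemma 7 / the input of Lemma 8 ("Recall (6.15) and (6.16)", p.24 L161); Theorem 3 takes only the
`α = 0`, `i = 2` instance.  A predicate on `(C, Ċ)` and the constants `(B, K₀, J₁)` (Theorems 4–7 instantiate it
at the many-fermion propagator (5.17)); never asserted. [cite: Salmhofer1998, Lemma 7–8 (p.22 L117 – p.23 L62)] -/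
def LoopBoundsHold (latt β eps0 : ℝ) (C Cdot : ℝ → FMom d → ℂ) (B K₀ J₁ : ℝ) : Prop :=
  (∀ t : ℝ, 0 ≤ t → ∀ α : Fin d → ℕ, miDeg α ≤ 2 → ∀ i : ℕ, 1 ≤ i →
    loopY latt β C Cdot α (i - 1) t ≤
      ENNReal.ofReal ((8 * J₁) ^ (i - 1) * B * epsT eps0 t ^ ((i : ℤ) - 2 - (miDeg α : ℤ)))) ∧
  (∀ t : ℝ, 0 ≤ t → ∀ α : Fin d → ℕ, miDeg α ≤ 2 → ∀ i : ℕ, 3 ≤ i →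
    loopY latt β C Cdot α (i - 1) t ≤
      ENNReal.ofReal ((8 * J₁) ^ (i - 1) * B * K₀ * twoLoopFactor d t * epsT eps0 t ^ ((i : ℤ) - 1 - (miDeg α : ℤ))))


/-- `Ĉ_t ≡ 0 ≡ Ċ_t` on the Matsubara frequencies for `t > log(βε₀/π)` (Lemma 4, p.19 L133–135: "If
`t > log(βε₀/π)`, then `Ĉ_t(p) = 0` for all `p ∈ ℝ × 𝓑`", read at `p₀ ↦ ω_β(p₀) ∈ 𝕄(β)`; Proposition 4 for the
finite volume).  The input of the `log(βε₀)` statements ("the upper integration limit is at most `log βε₀`",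
p.25 L146–147); for the many-fermion propagator of Theorems 3 (ii)–(iii), 4, 5, 7 it is a theorem (companion
`Salmhofer1998SkeletonInputs`, `vanishesBeyond_modelProp`) and is not repeated as a hypothesis there; kept as a
predicate for abstract scale families.
[cite: Salmhofer1998, Lemma 4 (p.19 L133–135)] -/
def VanishesBeyond (β eps0 : ℝ) (C Cdot : ℝ → FMom d → ℂ) : Prop :=
  ∀ t : ℝ, Real.log (β * eps0 / Real.pi) < t → ∀ (n : ℤ) (p : Mom d),
    C t (matsFreq β n, p) = 0 ∧ Cdot t (matsFreq β n, p) = 0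

/-- External legs with Matsubara frequencies `p₀ ∈ 𝕄(β) = {(π/β)(2n+1)}` (p.18 L121–125) — where the `β`-dependent
statements are read (the RGE defines the functions for almost all real `p₀`, p.24 L89–91).
[cite: Salmhofer1998, §5.3 (p.18 L121–125)] -/
def IsMats (β : ℝ) {m : ℕ} (P : Fin m → Leg d) : Prop := ∀ μ, ∃ n : ℤ, (P μ).1.1 = matsFreq β n

/-- **The hypotheses of Theorems 6–7 on the initial data** (p.24 L101–104 = p.25 L90–93): for all `m` and
`r ≥ 1`, `I_{mr}(0)` is `C²` in `(𝐩₁,…,𝐩_m)`, `|D^α I_{mr}(0)| ≤ K^{(0)}_{mr}` (`|α| ≤ 2`) with `K^{(0)}_{mr} ≥ 0`,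
`K^{(0)}_{mr} = 0` for `m > 2r+2`, and `K^{(0)}_{m1} = δ_{m4} v` with `v > 0`; and — explicit here, automatic in
print, whose Green functions are functions on the discrete set `Γ*^m` (p.17 L44–47, L110–111) — `I_{mr}(0)` is
Borel measurable in all leg variables (audit item 11; revision 2).
[cite: Salmhofer1998, Theorem 6 (p.24 L101–104) and §5.1 (p.17 L102–116)] -/
def InitialDataBounds (I : MomFamily d) (K0 : ℕ → ℕ → ℝ) (v : ℝ) : Prop :=
  (∀ m r : ℕ, Measurable (I m r 0)) ∧
  (∀ (m r : ℕ), 1 ≤ r → ∀ P : Fin m → Leg d,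
      ContDiff ℝ 2 fun q : Fin m → Mom d => I m r 0 (withSpatial P q)) ∧
  (∀ m r : ℕ, 0 ≤ K0 m r) ∧
  (∀ (m r : ℕ), 1 ≤ r → ∀ α : Fin m → Fin d → ℕ, lmiDeg α ≤ 2 →
      ∀ P : Fin m → Leg d, ‖multiLegPartial α (I m r 0) P‖ ≤ K0 m r) ∧
  (∀ m r : ℕ, 2 * r + 2 < m → K0 m r = 0) ∧
  0 < v ∧ (∀ m : ℕ, K0 m 1 = if m = 4 then v else 0)

/-- **(6.25) (TeX `\kKmrdef`)**, the recursion for the constants `K_{mr}` of Theorems 6–7: `K_{m1} = K^{(0)}_{m1}`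
and, for `r ≥ 2`, `K_{mr} = K^{(0)}_{mr} + (M₀/m) ∫dκ^S_{mr} i·i! (32J₁)^{i-1} K_{m₁r₁} K_{m₂r₂}` with the
SKELETON measure `m₁, m₂ ≥ 4` (audit item 4) and the degree bound `m̄(r) = 2r+2` (F7b `kappaSum`).  Typed as the
predicate "`K` satisfies (6.25) with the constant `M₀`" (print: `M₀ = 240 B K₀`, `B = max_α B_α` — audit item 2).
[cite: Salmhofer1998, Theorem 6 (6.25) (p.24 L107–115)] -/
def IsSkeletonK (K0 : ℕ → ℕ → ℝ) (M₀ J₁ : ℝ) (K : ℕ → ℕ → ℝ) : Prop :=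
  (∀ m : ℕ, K m 1 = K0 m 1) ∧
  ∀ m r : ℕ, 2 ≤ r →
    K m r = K0 m r + M₀ / m *
      Complex.re (kappaSum mfDeg m r fun r₁ m₁ r₂ m₂ i =>
        if 4 ≤ m₁ ∧ 4 ≤ m₂ then
          ((((i * i.factorial : ℕ) : ℝ) * (32 * J₁) ^ (i - 1) * K m₁ r₁ * K m₂ r₂ : ℝ) : ℂ)
        else 0)

/-- The dimension switch `(…)^{δ_{d,2}}` of (6.26)/(6.29)/(6.35)/(6.36): exponent `1` if `d = 2`, `0` otherwise.
[cite: Salmhofer1998, Theorem 6 (6.26) (p.24 L118–123)] -/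
def deltaTwo (d : ℕ) : ℕ := if d = 2 then 1 else 0

/-! ### §6.2 Theorem 3 (the ladder four-point function), Theorems 4–5 -/

/-- **Theorem 3 (p.23 L169 – p.24 L10; TeX `\BLsatz`)**, as printed ("There is a constant `L₂` such that
`|B^L_r(t)|_0 ≤ L₂^r (½(1+t))^{r-1} ≤ L₂^r |log(βε₀)|^{r-1}`.  The series `Σ_r B^L_r(t)` converges uniformly in
`t` and `P` if `|λ log βε₀| < L₂^{-1}`"; proof: "by induction from (6.17) by use of (6.15) with `i = 2` and
`α = 0`"), typed for the many-fermion propagator with the hypothesis that its functional `Y_{0,2}` obeys (6.8)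
at `i = 2`, `α = 0` (`Y_{0,2}(t) ≤ 8J₁ B`; print: `B₀ = 4`), for ladder
solutions `B^L_r` (`IsLadderSolution`) whose initial data are geometrically bounded, `|B^L_r(0)|_0 ≤ w^r`
(the implicit standing of "constant": `L₂` independent of `r`, `t`, `β`; it may depend on the model, `χ₁`, `w`,
`B`, `J₁`).  Typed (revision 4, like Theorems 4–7 — module docstring "How the theorems are typed") for the
many-fermion propagator (5.17) of a model of the §2.3 class in `d ≥ 2` with a cutoff `χ₁`, in the window
`βε₀ ≥ 6`, GIVEN the `α = 0`, `i = 2` instance of (6.8) for it (`Y_{0,2}(t) ≤ 8J₁B` on `loopY`; a theorem for this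
propagator with print's `B₀ = 4`, companion `ladderLoopHyp_modelProp`); Lemma 4's vanishing beyond `log(βε₀/π)` is
a theorem for this propagator and not repeated.  The first bound holds at all legs; the `log(βε₀)` bound and
the uniform convergence (of `Σ_r λ^r B^L_r`, on `t ≥ 0`) at Matsubara external frequencies.  Named fact
(licence F-093). `Sal98.T3` · Salmhofer 1998 Theorem 3 · p.23 L169–183.
[cite: Salmhofer1998, Theorem 3 (p.23 L169 – p.24 L10)] -/
def LadderFourPointBound : Prop :=
  ∀ (d : ℕ) (M : ModelData d) (χ₁ : ℝ → ℝ) (B J₁ w : ℝ),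
    2 ≤ d → M.Hyp → IsCutoff χ₁ → 0 ≤ B → 0 < J₁ → 0 ≤ w →
    ∃ L₂ : ℝ, 0 < L₂ ∧
    ∀ β : ℝ, 0 < β → 6 ≤ β * M.eps0 →
      (∀ t : ℝ, 0 ≤ t →
        loopY M.latt β (modelProp M χ₁) (modelPropDot M χ₁) (0 : Fin d → ℕ) 1 t ≤ ENNReal.ofReal (8 * J₁ * B)) →
    ∀ (BL : ℕ → ℝ → (Fin 4 → Leg d) → ℂ),
      IsLadderSolution M.latt β (modelProp M χ₁) (modelPropDot M χ₁) BL →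
      (∀ r : ℕ, 1 ≤ r → ∀ P : Fin 4 → Leg d, ‖BL r 0 P‖ ≤ w ^ r) →
      (∀ t : ℝ, 0 ≤ t → ∀ r : ℕ, 1 ≤ r → ∀ P : Fin 4 → Leg d,
          ‖BL r t P‖ ≤ L₂ ^ r * ((1 + t) / 2) ^ (r - 1)) ∧
      (∀ t : ℝ, 0 ≤ t → ∀ r : ℕ, 1 ≤ r → ∀ P : Fin 4 → Leg d, IsMats β P →
          ‖BL r t P‖ ≤ L₂ ^ r * |Real.log (β * M.eps0)| ^ (r - 1)) ∧
      (∀ lam : ℝ, |lam * Real.log (β * M.eps0)| < L₂⁻¹ →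
        TendstoUniformlyOn
          (fun (N : ℕ) (tp : ℝ × (Fin 4 → Leg d)) =>
            ∑ r ∈ Finset.range N, (lam : ℂ) ^ (r + 1) * BL (r + 1) tp.1 tp.2)
          (fun tp => ∑' r : ℕ, (lam : ℂ) ^ (r + 1) * BL (r + 1) tp.1 tp.2)
          atTop {tp | 0 ≤ tp.1 ∧ IsMats β tp.2})

/-- **Theorem 4 (p.24 L22–42; TeX `\skelnonRPA`)**, as printed up to audit item 6: "For all `r ≥ 1`, the skeleton
functions `I^N_{2,r}(t)` converge for `t → ∞` to a `C²` function.  There are constants `K^{(2)}_r` and `K^{(4)}_r`,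
independent of `β`, such that" **(6.20)** `|D^α I^N_{2,r}(t)|_0 ≤ K^{(2)}_r` (`|α| ≤ 1`), `K^{(2)}_r (log βε₀)²`
(`|α| = 2`, `d = 2`), `K^{(2)}_r log βε₀` (`|α| = 2`, `d ≥ 3`), and **(6.21)** `|D^α I^N_{4,r}(t)|_0 ≤ K^{(4)}_r`
(`α = 0`) — the `|α| = 1, 2` lines of (6.21) print `log βε₀` and `βε₀`; typed `(1 + log βε₀)²` and
`βε₀ (1 + log βε₀)`, the powers that follow from Theorem 6 by integration (audit item 6).  Typed (revision 2,
audit item 11) for the many-fermion propagator (5.17) of a model of the §2.3 class in `d ≥ 2` with `k₀ > d` and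
a cutoff `χ₁`, GIVEN the overlapping-loop bounds (6.8)/(6.9) for it with constants `(B, K₀, J₁)` (Lemma 7's
conclusion, `LoopBoundsHold`; Lemma 4's vanishing beyond `log(βε₀/π)` is a theorem for this propagator), for
solutions of the non-ladder skeleton RGE (Definition 3) with initial data as in Theorem 6 (`InitialDataBounds`);
constants existential BEFORE `β` (they may depend on the model, `χ₁`, `B, K₀, J₁, v, K^{(0)}`); read at Matsubara
external frequencies.  Named fact (licence F-094). `Sal98.T4` · Salmhofer 1998 Theorem 4 · p.24 L22–42.
[cite: Salmhofer1998, Theorem 4 (p.24 L22–42)] -/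
def SkeletonSelfEnergyRegularity : Prop :=
  ∀ (d : ℕ) (M : ModelData d) (χ₁ : ℝ → ℝ) (B K₀ J₁ v : ℝ) (K0 : ℕ → ℕ → ℝ),
    2 ≤ d → M.Hyp → d < M.k0 → IsCutoff χ₁ → 0 ≤ B → 0 < K₀ → 0 < J₁ →
    ∃ K2 K4 : ℕ → ℝ,
    ∀ β : ℝ, 0 < β → 6 ≤ β * M.eps0 →
      LoopBoundsHold M.latt β M.eps0 (modelProp M χ₁) (modelPropDot M χ₁) B K₀ J₁ →
    ∀ (I : MomFamily d), IsMomRGESolution M.latt β selNonLadder (modelProp M χ₁) (modelPropDot M χ₁) I →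
      InitialDataBounds I K0 v →
      ∀ r : ℕ, 1 ≤ r →
        (∃ S : (Fin 2 → Leg d) → ℂ,
          (∀ P : Fin 2 → Leg d, IsMats β P → Tendsto (fun t : ℝ => I 2 r t P) atTop (𝓝 (S P))) ∧
          (∀ P : Fin 2 → Leg d, IsMats β P → ContDiff ℝ 2 fun q : Fin 2 → Mom d => S (withSpatial P q))) ∧
        (∀ t : ℝ, 0 ≤ t → ∀ α : Fin 2 → Fin d → ℕ, lmiDeg α ≤ 2 → ∀ P : Fin 2 → Leg d, IsMats β P →
          (lmiDeg α ≤ 1 → ‖multiLegPartial α (I 2 r t) P‖ ≤ K2 r) ∧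
          (lmiDeg α = 2 → d = 2 → ‖multiLegPartial α (I 2 r t) P‖ ≤ K2 r * Real.log (β * M.eps0) ^ 2) ∧
          (lmiDeg α = 2 → 3 ≤ d → ‖multiLegPartial α (I 2 r t) P‖ ≤ K2 r * Real.log (β * M.eps0))) ∧
        (∀ t : ℝ, 0 ≤ t → ∀ α : Fin 4 → Fin d → ℕ, lmiDeg α ≤ 2 → ∀ P : Fin 4 → Leg d, IsMats β P →
          (lmiDeg α = 0 → ‖multiLegPartial α (I 4 r t) P‖ ≤ K4 r) ∧
          (lmiDeg α = 1 → ‖multiLegPartial α (I 4 r t) P‖ ≤ K4 r * (1 + Real.log (β * M.eps0)) ^ 2) ∧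
          (lmiDeg α = 2 →
            ‖multiLegPartial α (I 4 r t) P‖ ≤ K4 r * (β * M.eps0) * (1 + Real.log (β * M.eps0))))

/-- **Theorem 5 (p.24 L48–56; TeX `\skelsatz`)**, as printed: "The skeleton functions `I^S_{2,r}` and `I^S_{4,r}`
converge for `t → ∞` and satisfy **(6.22)** `|D^α I^S_{m,r}(t)|_0 ≤ K^{(5)}_{mr} (log βε₀)^r` for `m = 2`, `|α| ≤ 2`,
and `m = 4`, `|α| = 0`" ("If the ladder four-point function is left in the RGE, its logarithmic growth shows up
in all other Green functions", p.24 L44–46).  Typed (revision 2, audit item 11) for the many-fermion propagator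
(5.17) of a model of the §2.3 class in `d ≥ 2` with `k₀ > d` and a cutoff `χ₁`, given the overlapping-loop bounds
(6.8)/(6.9) for it (`LoopBoundsHold`), for solutions of the skeleton RGE of Definition 2 (ladder kept) with
initial data as in Theorem 7 (`InitialDataBounds`); constants existential before `β`; read at Matsubara external
frequencies.  Named fact (licence F-095). `Sal98.T5` · Salmhofer 1998 Theorem 5 · p.24 L48–56.
[cite: Salmhofer1998, Theorem 5 (p.24 L48–56)] -/
def SkeletonWithLadderBounds : Prop :=
  ∀ (d : ℕ) (M : ModelData d) (χ₁ : ℝ → ℝ) (B K₀ J₁ v : ℝ) (K0 : ℕ → ℕ → ℝ),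
    2 ≤ d → M.Hyp → d < M.k0 → IsCutoff χ₁ → 0 ≤ B → 0 < K₀ → 0 < J₁ →
    ∃ K5 : ℕ → ℕ → ℝ,
    ∀ β : ℝ, 0 < β → 6 ≤ β * M.eps0 →
      LoopBoundsHold M.latt β M.eps0 (modelProp M χ₁) (modelPropDot M χ₁) B K₀ J₁ →
    ∀ (I : MomFamily d), IsMomRGESolution M.latt β selSkeleton (modelProp M χ₁) (modelPropDot M χ₁) I →
      InitialDataBounds I K0 v →
      ∀ r : ℕ, 1 ≤ r →
        (∀ P : Fin 2 → Leg d, IsMats β P → ∃ z : ℂ, Tendsto (fun t : ℝ => I 2 r t P) atTop (𝓝 z)) ∧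
        (∀ P : Fin 4 → Leg d, IsMats β P → ∃ z : ℂ, Tendsto (fun t : ℝ => I 4 r t P) atTop (𝓝 z)) ∧
        ∀ t : ℝ, 0 ≤ t →
          (∀ α : Fin 2 → Fin d → ℕ, lmiDeg α ≤ 2 → ∀ P : Fin 2 → Leg d, IsMats β P →
            ‖multiLegPartial α (I 2 r t) P‖ ≤ K5 2 r * Real.log (β * M.eps0) ^ r) ∧
          (∀ P : Fin 4 → Leg d, IsMats β P → ‖I 4 r t P‖ ≤ K5 4 r * Real.log (β * M.eps0) ^ r)

/-! ### §6.3 Theorems 6 and 7 -/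

/-- **Theorem 6 (p.24 L99 – p.25 L62; TeX `\vorletzt`)**, the `β`-independent per-scale bounds for the Green
functions `I^N_{mr}(t)` generated by the skeleton (non-ladder) RGE of Definition 3 from initial data as in
`InitialDataBounds`, with `K_{m1} = K^{(0)}_{m1}` and `K_{mr}` (`r ≥ 2`) given by the recursion (6.25)
(`IsSkeletonK`): then `K_{mr} = 0` for `m > 2r+2`, and for all `t ≥ 0`, `|α| ≤ 2`:
**(6.26)** `|D^α Q^N_{mr}(t)|_0 ≤ c_m K_{mr} · {ε_t^{2-m/2-|α|} (m ≥ 6); ε_t^{1-|α|} (1+t) (m = 4);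
ε_t^{2-|α|} (1+t)^{δ_{d,2}} (m = 2)}`; **(6.27)** `|D^α I^N_{mr}(t)|_0 ≤ K_{mr} ε_t^{2-m/2-|α|}` (`m ≥ 6`);
**(6.28)** `|D^α I^N_{4r}(t)|_0 ≤ K_{4r} · {1 (α = 0); (1+t)² (|α| = 1); ε_t^{-1}(1+t) (|α| = 2)}`;
**(6.29)** `|D^α I^N_{2r}(t)|_0 ≤ K_{2r} · {1 (|α| ≤ 1); (1+t)² (|α| = 2, d = 2); (1+t) (|α| = 2, d ≥ 3)}`,
together with the `C²` regularity in the spatial momenta that these bounds presuppose.  PRINT vs TYPED (module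
docstring, audit items 1–5, 12): print has `((1+t)/2)^k` for `(1+t)^k`, `c_m = 2` for all `m` (typed `2` for
`m ∈ {2,4}`, `m - 4` for `m ≥ 6`), `M₀ = 240 B K₀` (typed `∃ M₀`, before `J₁`, `β` and the data), "`d = 3`" in
(6.29), and the `m ≥ 6` clauses carry `2 ∣ m` (print's `m/2` is real; odd `m` does not occur in the model, audit
item 12); each typed clause is implied by the printed one up to these absolute constants, and
all constants are independent of `β` and `t` — the theorem's point (p.24 L96–97).  Typed (revision 2, audit
item 11) for the many-fermion propagator (5.17) of a model of the §2.3 class in `d ≥ 2` with `k₀ > d` and a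
cutoff `χ₁`, GIVEN the overlapping-loop bounds (6.8)/(6.9) for it with constants `(B, K₀, J₁)` (`LoopBoundsHold`;
for this propagator they are Lemma 4 + Lemma 7); `M₀` existential before `J₁`, `β` and the data (it may depend
on the model, `χ₁`, `B`, `K₀`); legs arbitrary (real external frequencies, p.24 L89–91); no `β`-window is
needed.  Named fact (licence F-096). `Sal98.T6` · Salmhofer 1998 Theorem 6 · p.24 L99–147.
[cite: Salmhofer1998, Theorem 6 (p.24 L99 – p.25 L62)] -/
def SkeletonRegularity : Prop :=
  ∀ (d : ℕ) (M : ModelData d) (χ₁ : ℝ → ℝ) (B K₀ : ℝ),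
    2 ≤ d → M.Hyp → d < M.k0 → IsCutoff χ₁ → 0 ≤ B → 0 < K₀ →
    ∃ M₀ : ℝ, 0 < M₀ ∧
    ∀ (J₁ β : ℝ), 0 < J₁ → 0 < β →
      LoopBoundsHold M.latt β M.eps0 (modelProp M χ₁) (modelPropDot M χ₁) B K₀ J₁ →
    ∀ (I : MomFamily d) (K0 K : ℕ → ℕ → ℝ) (v : ℝ),
      IsMomRGESolution M.latt β selNonLadder (modelProp M χ₁) (modelPropDot M χ₁) I → InitialDataBounds I K0 v →
      IsSkeletonK K0 M₀ J₁ K →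
      (∀ m r : ℕ, 1 ≤ r → 2 * r + 2 < m → K m r = 0) ∧
      (∀ (m r : ℕ) (t : ℝ), 1 ≤ r → 0 ≤ t → ∀ P : Fin m → Leg d,
          ContDiff ℝ 2 fun q : Fin m → Mom d => I m r t (withSpatial P q)) ∧
      ∀ (t : ℝ), 0 ≤ t → ∀ (m r : ℕ), 1 ≤ r → ∀ α : Fin m → Fin d → ℕ, lmiDeg α ≤ 2 →
        ∀ P : Fin m → Leg d,
          let Q : ℝ := ‖multiLegPartial α
            (momQuadTerm M.latt β selNonLadder (modelProp M χ₁) (modelPropDot M χ₁) I I m r t) P‖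
          let D : ℝ := ‖multiLegPartial α (I m r t) P‖
          let ε : ℝ := epsT M.eps0 t
          let a : ℤ := lmiDeg α
          -- (6.26)
          (6 ≤ m → 2 ∣ m → Q ≤ ((m : ℝ) - 4) * K m r * ε ^ ((2 : ℤ) - (m / 2 : ℕ) - a)) ∧
          (m = 4 → Q ≤ 2 * K m r * ε ^ ((1 : ℤ) - a) * (1 + t)) ∧
          (m = 2 → Q ≤ 2 * K m r * ε ^ ((2 : ℤ) - a) * (1 + t) ^ deltaTwo d) ∧
          -- (6.27)
          (6 ≤ m → 2 ∣ m → D ≤ K m r * ε ^ ((2 : ℤ) - (m / 2 : ℕ) - a)) ∧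
          -- (6.28)
          (m = 4 → lmiDeg α = 0 → D ≤ K m r) ∧
          (m = 4 → lmiDeg α = 1 → D ≤ K m r * (1 + t) ^ 2) ∧
          (m = 4 → lmiDeg α = 2 → D ≤ K m r * ε⁻¹ * (1 + t)) ∧
          -- (6.29)
          (m = 2 → lmiDeg α ≤ 1 → D ≤ K m r) ∧
          (m = 2 → lmiDeg α = 2 → d = 2 → D ≤ K m r * (1 + t) ^ 2) ∧
          (m = 2 → lmiDeg α = 2 → 3 ≤ d → D ≤ K m r * (1 + t))

/-- **Theorem 7 (p.25 L88–148; TeX `\letzt`)**, the explicit-`β` bounds when the ladder part is kept: for the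
Green functions `I^S_{mr}(t)` generated by the skeleton RGE of Definition 2 from initial data as in Theorem 6,
with `K_{mr}` by (6.25): for all `t ≥ 0`, `|α| ≤ 2`, at Matsubara external frequencies, with `L = log(βε₀)`:
**(6.33)** `|D^α Q^S_{mr}(t)|_0 ≤ c_m K_{mr} L^{r-2} ε_t^{2-m/2-|α|}` (`m ≥ 4`); **(6.34)** `|D^α I^S_{mr}(t)|_0 ≤
K_{mr} L^{r-1} ε_t^{2-m/2-|α|}` (`m ≥ 4`); **(6.35)** `|D^α Q^S_{2r}(t)|_0 ≤ 2K_{2r} L^{r-2+δ_{d,2}} ε_t^{2-|α|}`;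
**(6.36)** `|D^α I^S_{2r}(t)|_0 ≤ K_{2r} L^{r-2} · {1 (|α| ≤ 1); L^{1+δ_{d,2}} (|α| = 2)}`.  PRINT vs TYPED: as for
Theorem 6 (`c_m`, `∃ M₀`, `2 ∣ m` on the `m/2` clauses — audit item 12); exponents `r - 2` are natural-number
subtractions (audit item 10).  Typed (revision 2,
audit item 11) for the many-fermion propagator (5.17) of a model of the §2.3 class in `d ≥ 2` with `k₀ > d` and a
cutoff `χ₁`, given the overlapping-loop bounds (6.8)/(6.9) for it (`LoopBoundsHold`), in the window `βε₀ ≥ 6`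
(Lemma 4's vanishing beyond `log(βε₀/π)` — "the upper integration limit is at most `log βε₀`", p.25 L146–147 —
is a theorem for this propagator); read at Matsubara external frequencies.  Named fact (licence F-097).
`Sal98.T7` · Salmhofer 1998 Theorem 7 · p.25 L88–125. [cite: Salmhofer1998, Theorem 7 (p.25 L88–148)] -/
def SkeletonLogBounds : Prop :=
  ∀ (d : ℕ) (M : ModelData d) (χ₁ : ℝ → ℝ) (B K₀ : ℝ),
    2 ≤ d → M.Hyp → d < M.k0 → IsCutoff χ₁ → 0 ≤ B → 0 < K₀ →
    ∃ M₀ : ℝ, 0 < M₀ ∧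
    ∀ (J₁ β : ℝ), 0 < J₁ → 0 < β → 6 ≤ β * M.eps0 →
      LoopBoundsHold M.latt β M.eps0 (modelProp M χ₁) (modelPropDot M χ₁) B K₀ J₁ →
    ∀ (I : MomFamily d) (K0 K : ℕ → ℕ → ℝ) (v : ℝ),
      IsMomRGESolution M.latt β selSkeleton (modelProp M χ₁) (modelPropDot M χ₁) I → InitialDataBounds I K0 v →
      IsSkeletonK K0 M₀ J₁ K →
      ∀ (t : ℝ), 0 ≤ t → ∀ (m r : ℕ), 1 ≤ r → ∀ α : Fin m → Fin d → ℕ, lmiDeg α ≤ 2 →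
        ∀ P : Fin m → Leg d, IsMats β P →
          let Q : ℝ := ‖multiLegPartial α
            (momQuadTerm M.latt β selSkeleton (modelProp M χ₁) (modelPropDot M χ₁) I I m r t) P‖
          let D : ℝ := ‖multiLegPartial α (I m r t) P‖
          let ε : ℝ := epsT M.eps0 t
          let a : ℤ := lmiDeg α
          let L : ℝ := Real.log (β * M.eps0)
          -- (6.33)
          (6 ≤ m → 2 ∣ m → Q ≤ ((m : ℝ) - 4) * K m r * L ^ (r - 2) * ε ^ ((2 : ℤ) - (m / 2 : ℕ) - a)) ∧
          (m = 4 → Q ≤ 2 * K m r * L ^ (r - 2) * ε ^ (-a)) ∧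
          -- (6.34)
          (4 ≤ m → 2 ∣ m → D ≤ K m r * L ^ (r - 1) * ε ^ ((2 : ℤ) - (m / 2 : ℕ) - a)) ∧
          -- (6.35)
          (m = 2 → Q ≤ 2 * K m r * L ^ (r - 2 + deltaTwo d) * ε ^ ((2 : ℤ) - a)) ∧
          -- (6.36)
          (m = 2 → lmiDeg α ≤ 1 → D ≤ K m r * L ^ (r - 2)) ∧
          (m = 2 → lmiDeg α = 2 → D ≤ K m r * L ^ (r - 2) * L ^ (1 + deltaTwo d))

/-! ### Unfolding lemmas (proved) -/

/-- `|F|_0 ≤ K` iff `|F(P)| ≤ K` at every leg configuration (`K ≥ 0`). [cite: Salmhofer1998, §5.3 (p.18 L126–131)] -/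
theorem supNorm_le_ofReal_iff {m : ℕ} (F : (Fin m → Leg d) → ℂ) {K : ℝ} (hK : 0 ≤ K) :
    supNorm F ≤ ENNReal.ofReal K ↔ ∀ P : Fin m → Leg d, ‖F P‖ ≤ K := by
  simp only [supNorm, iSup_le_iff]
  refine forall_congr' fun P => ?_
  rw [← ofReal_norm]
  exact ENNReal.ofReal_le_ofReal_iff hK

/-- `∼∼K = K`. [cite: Salmhofer1998, §5.1 (p.17 L58)] -/
theorem legFlip_legFlip (K : Leg d) : legFlip (legFlip K) = K := by
  obtain ⟨k, σ, j⟩ := K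
  simp [legFlip, Fin.rev_rev]

/-- The many-fermion propagator at a Matsubara-ized argument is F7c's thermodynamic-limit propagator
`D̂_t(p) = 𝒞_t(ω_β(p₀), E(𝐩))`. [cite: Salmhofer1998, §5.4 (5.17) (p.19 L118–126)] -/
theorem modelProp_toMats (M : ModelData d) (χ₁ : ℝ → ℝ) (β t : ℝ) (k : FMom d) :
    modelProp M χ₁ t (toMats β k) = cutoffCovInf M χ₁ β t k.1 k.2 := rfl

/-- For the many-fermion propagator the left side of (5.21) in this file's loop normalisation is F7c's
`covL1Momentum`. [cite: Salmhofer1998, Lemma 4 (5.21) (p.19 L160–164)] -/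
theorem propL1_modelProp (M : ModelData d) (χ₁ : ℝ → ℝ) (β t : ℝ) :
    propL1 M.latt β (modelProp M χ₁) t = covL1Momentum M χ₁ β t := by
  unfold propL1 covL1Momentum loopWeight
  rw [pow_one]
  rfl

/-- Print's functional (6.7) (`Q ∈ 𝕄(β) × ℝ^d`) is dominated by the all-real-`Q` functional on which (6.8)/(6.9)
are typed: `loopYM ≤ loopY` (audit item 8). [cite: Salmhofer1998, §6.1 (6.7) (p.22 L108–115)] -/
theorem loopYM_le_loopY (latt β : ℝ) (C Cdot : ℝ → FMom d → ℂ) (α : Fin d → ℕ) (n : ℕ) (t : ℝ) :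
    loopYM latt β C Cdot α n t ≤ loopY latt β C Cdot α n t := by
  unfold loopYM loopY
  refine iSup_le fun n' => iSup_le fun q => ?_
  exact le_iSup_of_le (matsFreq β n', q) le_rfl

/-- With no integrated line (`i = 1`, `n = 0`) the all-real-`Q` functional is the plain supremum
`sup_{Q ∈ ℝ × ℝ^d} |D^α Ċ_t(Q)|` (the integral over `(ℝ × 𝓑)^0` is evaluation; audit item 8: this is why
Lemma 7's vanishing statement (o) is typed on `loopYM`, not on `loopY`).
[cite: Salmhofer1998, §6.1 (6.7) (p.22 L108–115)] -/
theorem loopY_zero_eq (latt β : ℝ) (C Cdot : ℝ → FMom d → ℂ) (α : Fin d → ℕ) (t : ℝ) :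
    loopY latt β C Cdot α 0 t = ⨆ Q : FMom d, ‖multiMomPartial α (Cdot t) Q‖ₑ := by
  unfold loopY
  refine iSup_congr fun Q => ?_
  have hset : loopSet d latt 0 = Set.univ := by
    ext k; simp [loopSet]
  have hμ : (volume : Measure (Fin 0 → FMom d)) = Measure.dirac (fun i => i.elim0) := by
    rw [MeasureTheory.volume_pi]
    exact Measure.pi_of_empty _ _
  simp [hset, hμ, loopWeight]

/-- Definition 2 removes every two-legged insertion: no term with `m₁ = 2` survives the skeleton selector.
[cite: Salmhofer1998, Definition 2 (p.23 L71–80)] -/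
theorem selSkeleton_two_left (m m₂ i : ℕ) : selSkeleton m 2 m₂ i = false := by
  simp [selSkeleton]

/-- Definition 3 removes the bubble `(m; m₁, m₂, i) = (4; 4, 4, 2)` of Figure 3 from the four-point equation, and
keeps the two-loop sunset `(2; 4, 4, 3)` of the self-energy equation ("Thus `i = ½(m₁+m₂-2) ≥ 3`", p.25 L52–53).
[cite: Salmhofer1998, Definition 3 (p.23 L142–160) and Theorem 6 proof (p.25 L40–53)] -/
theorem selNonLadder_bubble : selNonLadder 4 4 4 2 = false ∧ selNonLadder 2 4 4 3 = true := by
  simp [selNonLadder, selSkeleton]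

/-- `((1+t)/2)^{δ_{d,2}}` at `d = 2`. [cite: Salmhofer1998, Lemma 8 (6.16) (p.23 L55–62)] -/
theorem twoLoopFactor_two (t : ℝ) : twoLoopFactor 2 t = (1 + t) / 2 := by
  simp [twoLoopFactor]

/-- `((1+t)/2)^{δ_{d,2}} = 1` for `d ≥ 3`. [cite: Salmhofer1998, Lemma 8 (6.16) (p.23 L55–62)] -/
theorem twoLoopFactor_of_three_le {d : ℕ} (hd : 3 ≤ d) (t : ℝ) : twoLoopFactor d t = 1 := by
  simp [twoLoopFactor, show d ≠ 2 by omega]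

/-- The bilinear term has no `r = 1` component: `Q_{m,1} = 0` ("`r = 1` is trivial because `Q^N_{m1} = 0`",
p.24 L151; the sum `∫dκ_{mr}` runs over `r₁, r₂ ≥ 1` with `r₁ + r₂ = r`, p.18 L1–3).
[cite: Salmhofer1998, Theorem 6 proof (p.24 L149–152)] -/
theorem momQuadTerm_one (latt β : ℝ) (sel : ℕ → ℕ → ℕ → ℕ → Bool) (C Cdot : ℝ → FMom d → ℂ)
    (I₁ I₂ : MomFamily d) (m : ℕ) (t : ℝ) (P : Fin m → Leg d) :
    momQuadTerm latt β sel C Cdot I₁ I₂ m 1 t P = 0 := by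
  simp [momQuadTerm, kappaSum]

/-- The recursion (6.25) returns `K_{mr} = K^{(0)}_{mr} = 0` for `m > 2r + 2` ("Then `K_{mr} = 0` if
`m > 2r+2`", p.24 L116): every index of `∫dκ^S_{mr}` has `m₁ ≤ 2r₁+2`, `m₂ ≤ 2r₂+2`, `i ≥ 1`, whence
`m = m₁ + m₂ - 2i ≤ 2r + 2`. [cite: Salmhofer1998, Theorem 6 (p.24 L107–116)] -/
theorem IsSkeletonK.eq_zero_of_lt {K0 : ℕ → ℕ → ℝ} {M₀ J₁ : ℝ} {K : ℕ → ℕ → ℝ}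
    (hK : IsSkeletonK K0 M₀ J₁ K) (hK0 : ∀ m r : ℕ, 2 * r + 2 < m → K0 m r = 0)
    {m r : ℕ} (hr : 1 ≤ r) (hm : 2 * r + 2 < m) : K m r = 0 := by
  rcases Nat.lt_or_ge r 2 with hr2 | hr2
  · obtain rfl : r = 1 := by omega
    rw [hK.1 m, hK0 m 1 hm]
  · rw [hK.2 m r hr2, hK0 m r hm, zero_add]
    have hsum : (kappaSum mfDeg m r fun r₁ m₁ r₂ m₂ i =>
        if 4 ≤ m₁ ∧ 4 ≤ m₂ then
          ((((i * i.factorial : ℕ) : ℝ) * (32 * J₁) ^ (i - 1) * K m₁ r₁ * K m₂ r₂ : ℝ) : ℂ)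
        else 0) = 0 := by
      unfold kappaSum
      refine Finset.sum_eq_zero fun r₁ hr₁ => Finset.sum_eq_zero fun m₁ hm₁ =>
        Finset.sum_eq_zero fun m₂ hm₂ => Finset.sum_eq_zero fun i hi => ?_
      simp only [Finset.mem_Icc] at hr₁ hm₁ hm₂ hi
      have hidx : MIndex mfDeg r₁ (r - r₁) m m₁ m₂ i = false := by
        rw [Bool.eq_false_iff]
        intro h
        simp only [MIndex, mfDeg, Bool.and_eq_true, decide_eq_true_eq] at h
        omega
      simp [hidx]
    rw [hsum]
    simp

end Salmhofer1998

end Literature.MathematicalPhysics.QuantumLattice.FermiRG
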